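import Summits.RiemannHypothesis.RiemannHypothesis.Theses.RuelleBand

/-!
# `RuelleBand.ZetaWeakRecurrence`, line `Sketch` — stub `stub_approximant_of_noInteriorZero`
(crux stmt-RiemannHypothesis-18110, route route-RiemannHypothesis-RuelleBand)

**No interior zero ⟹ approximable at every level.** On a closed disc `|s − z| ≤ r` of the
half-strip `1/2 < σ < 1` (`0 < r < min (Re z − 1/2, 1 − Re z)`) on whose OPEN interior `ζ` has no
zero (zeros on the circle `|s − z| = r` are allowed), for every `ε > 0` there are `R > r`, `η > 0`
and a function `g`, holomorphic on `|s − z| < R` and zero-free on the closed disc, with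
`|ζ − g| ≤ ε − η` on the closed disc.

Construction: the radial contraction `g(s) := ζ(z + (1 − θ)(s − z))` for a small `0 < θ < 1`,
`η := ε/2`, `R := 1 − Re z`. The contraction maps the open disc `|s − z| < 1 − Re z` into itself
(so the argument of `ζ` stays away from the pole `1` and `g` is holomorphic there), maps the closed
disc `|s − z| ≤ r` into the open disc `|s − z| < r` (so `g` is zero-free on it), and moves each
point of the closed disc by at most `θ r`; uniform continuity of `ζ` on the compact closed disc
then gives `|ζ − g| ≤ ε/2` for `θ` small. [folklore]

Main result: `RuelleBandZetaWeakRecurrence.stub_approximant_of_noInteriorZero` (registered stub of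
the line skeleton, uncurried signature verbatim).
-/

-- D-0017: single-problem summit; the lakefile turns this linter off for `Summits`; repeated here so that
-- standalone elaboration is warning-free as well.
set_option linter.dupNamespace false

noncomputable section

open Complex Set Metric Filter Topology

namespace Summit.RiemannHypothesis.RiemannHypothesis.Theorems.RuelleBandZetaWeakRecurrence

/-- A point of the open disc `|w − z| < 1 − Re z` is not the pole `1` of `ζ`. -/
theorem ne_one_of_mem_ball_one_sub_re {z w : ℂ} (hw : w ∈ Metric.ball z (1 - z.re)) : w ≠ 1 := by
  rintro rfl
  rw [mem_ball, dist_eq_norm] at hw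
  have h1 := abs_re_le_norm ((1 : ℂ) - z)
  rw [sub_re, one_re, abs_le] at h1
  linarith [h1.2]

/-- The radial contraction `s ↦ z + (1 − θ)(s − z)` (`θ ≤ 1`) scales distances to the centre `z`
by the factor `1 − θ`. -/
theorem dist_contraction_center (z s : ℂ) {θ : ℝ} (hθ : θ ≤ 1) :
    dist (z + ((1 - θ : ℝ) : ℂ) * (s - z)) z = (1 - θ) * dist s z := by
  rw [dist_eq_norm, dist_eq_norm, add_sub_cancel_left, norm_mul,
    Complex.norm_of_nonneg (sub_nonneg.2 hθ)]

/-- The radial contraction `s ↦ z + (1 − θ)(s − z)` (`0 ≤ θ`) moves `s` by `θ · |s − z|`. -/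
theorem dist_contraction_self (z s : ℂ) {θ : ℝ} (hθ : 0 ≤ θ) :
    dist s (z + ((1 - θ : ℝ) : ℂ) * (s - z)) = θ * dist s z := by
  have h : s - (z + ((1 - θ : ℝ) : ℂ) * (s - z)) = (θ : ℂ) * (s - z) := by
    push_cast
    ring
  rw [dist_eq_norm, dist_eq_norm, h, norm_mul, Complex.norm_of_nonneg hθ]

/-- The radial contraction by a factor `1 − θ ∈ [0, 1]` maps every open disc about `z` into
itself. -/
theorem contraction_mem_ball {z s : ℂ} {θ ρ : ℝ} (hθ0 : 0 ≤ θ) (hθ1 : θ ≤ 1)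
    (hs : s ∈ Metric.ball z ρ) : z + ((1 - θ : ℝ) : ℂ) * (s - z) ∈ Metric.ball z ρ := by
  rw [mem_ball] at hs ⊢
  rw [dist_contraction_center z s hθ1]
  calc (1 - θ) * dist s z ≤ 1 * dist s z := by gcongr; linarith
    _ = dist s z := one_mul _
    _ < ρ := hs

/-- The radial contraction by a factor `1 − θ` with `0 < θ ≤ 1` maps the closed disc of positive
radius `ρ` about `z` into the open disc of the same radius. -/
theorem contraction_mem_ball_of_mem_closedBall {z s : ℂ} {θ ρ : ℝ} (hθ0 : 0 < θ) (hθ1 : θ ≤ 1)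
    (hρ : 0 < ρ) (hs : s ∈ Metric.closedBall z ρ) :
    z + ((1 - θ : ℝ) : ℂ) * (s - z) ∈ Metric.ball z ρ := by
  rw [mem_closedBall] at hs
  rw [mem_ball, dist_contraction_center z s hθ1]
  calc (1 - θ) * dist s z ≤ (1 - θ) * ρ := mul_le_mul_of_nonneg_left hs (sub_nonneg.2 hθ1)
    _ < ρ := by nlinarith

/-- The radial contraction `s ↦ z + (1 − θ)(s − z)` is differentiable. -/
theorem differentiable_contraction (z : ℂ) (θ : ℝ) :
    Differentiable ℂ fun s : ℂ ↦ z + ((1 - θ : ℝ) : ℂ) * (s - z) :=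
  ((differentiable_id.sub_const z).const_mul _).const_add z

/-- `ζ` is continuous on every closed disc `|s − z| ≤ r` with `r < 1 − Re z` (the disc misses the
pole `1`). -/
theorem continuousOn_riemannZeta_closedBall {z : ℂ} {r : ℝ} (hr : r < 1 - z.re) :
    ContinuousOn riemannZeta (Metric.closedBall z r) := fun _ hw ↦
  (differentiableAt_riemannZeta
    (ne_one_of_mem_ball_one_sub_re (closedBall_subset_ball hr hw))).continuousAt.continuousWithinAt

/-- **Stub 2 of line `Sketch` (no interior zero ⟹ approximable at every level).**
If `ζ` has no zero in the OPEN disc `|s − z| < r` of the half-strip (zeros on the circle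
`|s − z| = r` allowed), then for every `ε > 0` the closed disc `|s − z| ≤ r` admits a zero-free
`(ε − η)`-approximant of `ζ` holomorphic on a larger disc: the radial contraction
`g(s) = ζ(z + (1 − θ)(s − z))` for small `θ > 0`, with `η = ε/2` and `R = 1 − Re z`. [folklore] -/
theorem stub_approximant_of_noInteriorZero :
    ∀ (z : ℂ) (r : ℝ), 0 < r → r < min (z.re - 1 / 2) (1 - z.re) →
      (∀ s ∈ Metric.ball z r, riemannZeta s ≠ 0) → ∀ ε : ℝ, 0 < ε →
      ∃ (R η : ℝ) (g : ℂ → ℂ), r < R ∧ 0 < η ∧ DifferentiableOn ℂ g (Metric.ball z R) ∧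
        (∀ s ∈ Metric.closedBall z r, g s ≠ 0) ∧
        ∀ s ∈ Metric.closedBall z r, ‖riemannZeta s - g s‖ ≤ ε - η := by
  intro z r hr hrmin hZ ε hε
  have hr1 : r < 1 - z.re := hrmin.trans_le (min_le_right _ _)
  -- uniform continuity of `ζ` on the compact disc `|s − z| ≤ r` at level `ε / 2`
  obtain ⟨δ, hδ, hUC⟩ := Metric.uniformContinuousOn_iff_le.1
    ((isCompact_closedBall z r).uniformContinuousOn_of_continuous
      (continuousOn_riemannZeta_closedBall hr1)) (ε / 2) (half_pos hε)
  -- the contraction parameter `θ`: `0 < θ < 1` and `θ r ≤ δ`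
  set θ : ℝ := min (1 / 2) (δ / r) with hθdef
  have hθpos : 0 < θ := lt_min one_half_pos (div_pos hδ hr)
  have hθle1 : θ ≤ 1 := (min_le_left _ _).trans (by norm_num)
  have hθr : θ * r ≤ δ :=
    calc θ * r ≤ δ / r * r := by gcongr; exact min_le_right _ _
      _ = δ := div_mul_cancel₀ δ hr.ne'
  refine ⟨1 - z.re, ε / 2, fun s ↦ riemannZeta (z + ((1 - θ : ℝ) : ℂ) * (s - z)), hr1,
    half_pos hε, ?_, ?_, ?_⟩
  · -- holomorphic on `|s − z| < 1 − Re z`: the contraction keeps the argument off the pole `1`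
    intro s hs
    exact ((differentiableAt_riemannZeta (ne_one_of_mem_ball_one_sub_re
      (contraction_mem_ball hθpos.le hθle1 hs))).comp s
        (differentiable_contraction z θ s)).differentiableWithinAt
  · -- zero-free on `|s − z| ≤ r`: the contraction lands in the open disc, where `ζ ≠ 0`
    intro s hs
    exact hZ _ (contraction_mem_ball_of_mem_closedBall hθpos hθle1 hr hs)
  · -- `(ε − ε/2)`-close to `ζ` on `|s − z| ≤ r`: the contraction moves `s` by `θ |s − z| ≤ θ r ≤ δ`
    intro s hs
    have hs' : z + ((1 - θ : ℝ) : ℂ) * (s - z) ∈ Metric.closedBall z r :=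
      ball_subset_closedBall (contraction_mem_ball_of_mem_closedBall hθpos hθle1 hr hs)
    have hd : dist s (z + ((1 - θ : ℝ) : ℂ) * (s - z)) ≤ δ := by
      rw [dist_contraction_self z s hθpos.le]
      calc θ * dist s z ≤ θ * r := by gcongr; exact mem_closedBall.1 hs
        _ ≤ δ := hθr
    calc ‖riemannZeta s - riemannZeta (z + ((1 - θ : ℝ) : ℂ) * (s - z))‖
        = dist (riemannZeta s) (riemannZeta (z + ((1 - θ : ℝ) : ℂ) * (s - z))) :=
          (dist_eq_norm _ _).symm
      _ ≤ ε / 2 := hUC s hs _ hs' hd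
      _ = ε - ε / 2 := by ring

end Summit.RiemannHypothesis.RiemannHypothesis.Theorems.RuelleBandZetaWeakRecurrence

end
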